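import Mathlib
import Literature.Analysis.FluidPDE.VectorCalculus
import Summits.NavierStokesRegularity.NavierStokesRegularity.Theorems.ThreadingFluxErtelTowerStrainShadowFrame
import HarnessLib

/-!
# Crux `PoloidalLiouville` (stmt-NavierStokesRegularity-1222, W1), crux idea «radial-jerk-tower» (ns-idea-15 g7):
# POTENTIAL JERK RIGIDITY — the AFFINE-QUADRATIC STRATUM (non-stagnation centre)

Support file (`--supports stmt-NavierStokesRegularity-1222`, helper).  Experiment cell `ns-wall-extremal`, width hand
ns-wall-eng-5 g7; critic of record ns-wall-crit-1 g5 (menu item (β), «S–M, NO STRIKE»).  0 kit.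

The twelfth Part B Prop of `ErtelTowerSketch.lean` v1.1, `PotentialJerkRigidity` (Defs twin p692432), is a CONJECTURE: a
harmonic `h` near `x₀` whose radial-jerk tower (steady drift `u = ∇h`) has pointwise rank `≤ 2` should be axisymmetric about an
axis through `x₀`.  The sketch decides the quadratic level AT A STAGNATION CENTRE (`vandermonde_closure`).  Here we decide
the first stratum at a NON-STAGNATION centre: the affine-quadratic harmonic potentials
`h(x) = h₀ + ⟪v, x⟫ + ½ xᵀSx`, `S = diag(a,b,c)`, `a + b + c = 0`, `v` ARBITRARY (centre `x₀ = 0`, principal frame WLOG),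
using only the `(0,1,2)`-minor of the tower on a ball: `⟪∇θ₀, ∇θ₁ × ∇θ₂⟫ = ⟪x, (v + 2Sx) × (3Sv + 4S²x)⟫ ≡ 0`.  Along a ray
`x = t·y` this is `t·P₁(y) + t²·P₂(y) + t³·P₃(y)`; four radii `±s, ±s/2` inside the ball give `P₂(y) = P₃(y) = 0`;
`P₃(1,1,1) = 8(a−b)(b−c)(c−a)` (Vandermonde) forces two equal principal strains, and `P₂` at `(1,1,0)`, `(1,0,1)`, `(0,1,1)`
(`= −10c(a−b)v₂`, `10b(c−a)v₁`, `−10a(b−c)v₀`) kills the components of `v` off the symmetry axis.  Hence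
★ `potentialJerkRigidity_affineQuadratic`: `∃ e ≠ 0, ∀ x, Dh(x)[e × x] = 0`.

Lemmas: `gradient_affineQuadratic` (`∇h = v + Sx`), `radialJerk_one/two_affineQuadratic` and `gradient_thetaOne/Two_…`
(`∇θ₁ = v + 2Sx`, `∇θ₂ = 3Sv + 4S²x`), `minor_affineQuadratic_ray` (the cubic in `t` along a ray), `cubic_coeffs_eq_zero`.

BOOKING: a stratum of a CONJECTURE-status Prop about the INVISCID linearised shadow (W2 side of the card); helper,
information-grade, W1/W2 movement 0; `PotentialJerkRigidity` itself stays a CONJECTURE (homogeneous strata hold on paper via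
isoparametric functions on `S²`, see HOME note; the general non-stagnation centre is open).  `PoloidalLiouville` (1222) /
(27585) OPEN; NS regularity NOT proved.
-/

-- the summit and its single problem share the name (D-0017 nested layout)
set_option linter.dupNamespace false

noncomputable section

namespace Summit.NavierStokesRegularity.NavierStokesRegularity.Theorems.PoloidalLiouville.ErtelTower

open Set Function Filter Topology Metric
open scoped Topology RealInnerProductSpace InnerProductSpace
open Literature.Analysis.FluidPDE
open Summit.NavierStokesRegularity.NavierStokesRegularity.Theorems.PoloidalLiouville.HorizonTower (E3)

section AffineQuadratic

variable (h₀ a b c : ℝ) (v : E3)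

/-- `D(h₀ + ⟪v,x⟫ + ½xᵀSx)[w] = ⟪v + Sx, w⟫`. -/
theorem fderiv_affineQuadratic_apply (x w : E3) :
    fderiv ℝ (fun y : E3 => h₀ + inner ℝ v y + quadForm a b c y / 2) x w = inner ℝ (v + strain a b c x) w := by
  have h1 : HasFDerivAt (fun y : E3 => inner ℝ v y) (innerSL ℝ v) x := (innerSL ℝ v).hasFDerivAt
  have h2 : HasFDerivAt (quadForm a b c) (fderiv ℝ (quadForm a b c) x) x :=
    ((contDiff_quadForm a b c (n := 1)).differentiable (by simp) x).hasFDerivAt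
  have h3 : HasFDerivAt (fun y : E3 => h₀ + inner ℝ v y + quadForm a b c y / 2)
      (innerSL ℝ v + (2 : ℝ)⁻¹ • fderiv ℝ (quadForm a b c) x) x := by
    have h := (h1.const_add h₀).add (h2.const_mul (2 : ℝ)⁻¹)
    have hfun : (fun y : E3 => h₀ + inner ℝ v y + quadForm a b c y / 2)
        = fun y => h₀ + inner ℝ v y + (2 : ℝ)⁻¹ * quadForm a b c y := by
      funext y; ring
    rw [hfun]
    exact h
  rw [h3.fderiv]
  simp only [add_apply, innerSL_apply_apply, smul_apply, smul_eq_mul, fderiv_quadForm_apply, inner_add_left]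
  ring

/-- `∇(h₀ + ⟪v,x⟫ + ½xᵀSx) = v + Sx`. -/
theorem gradient_affineQuadratic (x : E3) :
    gradient (fun y : E3 => h₀ + inner ℝ v y + quadForm a b c y / 2) x = v + strain a b c x := by
  apply ext_inner_right ℝ
  intro w
  rw [Literature.Analysis.FluidPDE.inner_gradient_left, fderiv_affineQuadratic_apply]

/-- Level 1 of the tower for the steady drift `u = v + Sx` about `0`: `θ₁ = ⟪v + Sx, x⟫`. -/
theorem radialJerk_one_affineQuadratic (t : ℝ) :
    radialJerk (fun (_ : ℝ) (z : E3) => v + strain a b c z) 0 1 t = fun x => inner ℝ (v + strain a b c x) x := by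
  funext x
  simp only [radialJerk_one, sub_zero]

/-- `D⟪v + Sx, x⟫[w] = ⟪v + 2Sx, w⟫`. -/
theorem fderiv_thetaOne_affineQuadratic_apply (x w : E3) :
    fderiv ℝ (fun y : E3 => inner ℝ (v + strain a b c y) y) x w = inner ℝ (v + (2 : ℝ) • strain a b c x) w := by
  have hfun : (fun y : E3 => inner ℝ (v + strain a b c y) y) = fun y => inner ℝ v y + quadForm a b c y := by
    funext y; rw [inner_add_left, strain_dot_self]
  have h1 : HasFDerivAt (fun y : E3 => inner ℝ v y) (innerSL ℝ v) x := (innerSL ℝ v).hasFDerivAt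
  have h2 : HasFDerivAt (quadForm a b c) (fderiv ℝ (quadForm a b c) x) x :=
    ((contDiff_quadForm a b c (n := 1)).differentiable (by simp) x).hasFDerivAt
  have h3 : HasFDerivAt (fun y : E3 => inner ℝ v y + quadForm a b c y) (innerSL ℝ v + fderiv ℝ (quadForm a b c) x) x :=
    h1.add h2
  rw [hfun, h3.fderiv]
  simp only [add_apply, innerSL_apply_apply, fderiv_quadForm_apply, inner_add_left, real_inner_smul_left]

/-- `∇θ₁ = v + 2Sx`. -/
theorem gradient_thetaOne_affineQuadratic (x : E3) :
    gradient (fun y : E3 => inner ℝ (v + strain a b c y) y) x = v + (2 : ℝ) • strain a b c x := by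
  apply ext_inner_right ℝ
  intro w
  rw [Literature.Analysis.FluidPDE.inner_gradient_left, fderiv_thetaOne_affineQuadratic_apply]

/-- Level 2 of the tower: `θ₂ = ⟪v + Sx, v + 2Sx⟫`. -/
theorem radialJerk_two_affineQuadratic (t : ℝ) :
    radialJerk (fun (_ : ℝ) (z : E3) => v + strain a b c z) 0 2 t
      = fun x => inner ℝ (v + strain a b c x) (v + (2 : ℝ) • strain a b c x) := by
  funext x
  show deriv (fun s => radialJerk (fun (_ : ℝ) (z : E3) => v + strain a b c z) 0 1 s x) t
      + inner ℝ (v + strain a b c x) (gradient (radialJerk (fun (_ : ℝ) (z : E3) => v + strain a b c z) 0 1 t) x)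
      = inner ℝ (v + strain a b c x) (v + (2 : ℝ) • strain a b c x)
  have hconst : (fun s : ℝ => radialJerk (fun (_ : ℝ) (z : E3) => v + strain a b c z) 0 1 s x)
      = fun _ => inner ℝ (v + strain a b c x) x := by
    funext s; rw [radialJerk_one_affineQuadratic]
  rw [hconst, deriv_const, zero_add, radialJerk_one_affineQuadratic, gradient_thetaOne_affineQuadratic]

/-- `θ₂` in coordinates. -/
theorem thetaTwo_affineQuadratic_eq (x : E3) :
    inner ℝ (v + strain a b c x) (v + (2 : ℝ) • strain a b c x)
      = (v 0 ^ 2 + v 1 ^ 2 + v 2 ^ 2) + 3 * (a * v 0 * x 0 + b * v 1 * x 1 + c * v 2 * x 2)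
        + quadForm (2 * a ^ 2) (2 * b ^ 2) (2 * c ^ 2) x := by
  rw [inner_add_left, inner_add_right, inner_add_right, real_inner_smul_right, real_inner_smul_right,
    real_inner_self_eq_norm_sq, real_inner_self_eq_norm_sq, real_inner_comm (strain a b c x) v, inner_strain,
    norm_sq_strain, EuclideanSpace.real_norm_sq_eq, Fin.sum_univ_three]
  simp only [quadForm]
  ring

/-- `Dθ₂[w] = ⟪3Sv + 4S²x, w⟫`. -/
theorem fderiv_thetaTwo_affineQuadratic_apply (x w : E3) :
    fderiv ℝ (fun y : E3 => inner ℝ (v + strain a b c y) (v + (2 : ℝ) • strain a b c y)) x w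
      = inner ℝ ((3 : ℝ) • strain a b c v + (4 : ℝ) • strain (a ^ 2) (b ^ 2) (c ^ 2) x) w := by
  have hfun : (fun y : E3 => inner ℝ (v + strain a b c y) (v + (2 : ℝ) • strain a b c y))
      = fun y => (v 0 ^ 2 + v 1 ^ 2 + v 2 ^ 2) + inner ℝ ((3 : ℝ) • strain a b c v) y
          + quadForm (2 * a ^ 2) (2 * b ^ 2) (2 * c ^ 2) y := by
    funext y
    rw [thetaTwo_affineQuadratic_eq, real_inner_smul_left, inner_strain]
  have h1 : HasFDerivAt (fun y : E3 => inner ℝ ((3 : ℝ) • strain a b c v) y) (innerSL ℝ ((3 : ℝ) • strain a b c v)) x :=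
    (innerSL ℝ ((3 : ℝ) • strain a b c v)).hasFDerivAt
  have h2 : HasFDerivAt (quadForm (2 * a ^ 2) (2 * b ^ 2) (2 * c ^ 2))
      (fderiv ℝ (quadForm (2 * a ^ 2) (2 * b ^ 2) (2 * c ^ 2)) x) x :=
    ((contDiff_quadForm (2 * a ^ 2) (2 * b ^ 2) (2 * c ^ 2) (n := 1)).differentiable (by simp) x).hasFDerivAt
  have h3 : HasFDerivAt (fun y : E3 => (v 0 ^ 2 + v 1 ^ 2 + v 2 ^ 2) + inner ℝ ((3 : ℝ) • strain a b c v) y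
      + quadForm (2 * a ^ 2) (2 * b ^ 2) (2 * c ^ 2) y)
      (innerSL ℝ ((3 : ℝ) • strain a b c v) + fderiv ℝ (quadForm (2 * a ^ 2) (2 * b ^ 2) (2 * c ^ 2)) x) x :=
    (h1.const_add _).add h2
  rw [hfun, h3.fderiv]
  simp only [add_apply, innerSL_apply_apply, fderiv_quadForm_apply, inner_add_left, real_inner_smul_left, inner_strain]
  ring

/-- `∇θ₂ = 3Sv + 4S²x`. -/
theorem gradient_thetaTwo_affineQuadratic (x : E3) :
    gradient (fun y : E3 => inner ℝ (v + strain a b c y) (v + (2 : ℝ) • strain a b c y)) x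
      = (3 : ℝ) • strain a b c v + (4 : ℝ) • strain (a ^ 2) (b ^ 2) (c ^ 2) x := by
  apply ext_inner_right ℝ
  intro w
  rw [Literature.Analysis.FluidPDE.inner_gradient_left, fderiv_thetaTwo_affineQuadratic_apply]

/-- **The `(0,1,2)`-minor along a ray.**  `⟪t·y, (v + 2S(ty)) × (3Sv + 4S²(ty))⟫ = t·P₁(y) + t²·P₂(y) + t³·P₃(y)` with the
explicit coordinate polynomials `P₁ = 3·det(y, v, Sv)`, `P₂ = 4·det(y, v, S²y) + 6·det(y, Sy, Sv)`,
`P₃ = 8·det(y, Sy, S²y)`. -/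
theorem minor_affineQuadratic_ray (y : E3) (t : ℝ) :
    inner ℝ (t • y) (cross (v + (2 : ℝ) • strain a b c (t • y))
        ((3 : ℝ) • strain a b c v + (4 : ℝ) • strain (a ^ 2) (b ^ 2) (c ^ 2) (t • y)))
      = t * (3 * (y 0 * (v 1 * (c * v 2) - v 2 * (b * v 1)) - y 1 * (v 0 * (c * v 2) - v 2 * (a * v 0))
                + y 2 * (v 0 * (b * v 1) - v 1 * (a * v 0))))
        + t ^ 2 * (4 * (y 0 * (v 1 * (c ^ 2 * y 2) - v 2 * (b ^ 2 * y 1)) - y 1 * (v 0 * (c ^ 2 * y 2) - v 2 * (a ^ 2 * y 0))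
                + y 2 * (v 0 * (b ^ 2 * y 1) - v 1 * (a ^ 2 * y 0)))
              + 6 * (y 0 * (b * y 1 * (c * v 2) - c * y 2 * (b * v 1)) - y 1 * (a * y 0 * (c * v 2) - c * y 2 * (a * v 0))
                + y 2 * (a * y 0 * (b * v 1) - b * y 1 * (a * v 0))))
        + t ^ 3 * (8 * ((a - b) * (b - c) * (c - a)) * (y 0 * y 1 * y 2)) := by
  simp [cross, crossProduct, strain, EuclideanSpace.inner_eq_star_dotProduct, dotProduct, Fin.sum_univ_three,
    Matrix.vecHead, Matrix.vecTail, Function.comp_apply, Fin.succ_zero_eq_one, Fin.succ_one_eq_two]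
  ring

/-- A real cubic `αt + βt² + γt³` vanishing at `t = ±s, ±s/2` with `s ≠ 0` has `β = γ = 0` (and then `α = 0`). -/
theorem cubic_coeffs_eq_zero {α β γ s : ℝ} (hs : s ≠ 0)
    (h1 : s * α + s ^ 2 * β + s ^ 3 * γ = 0) (h2 : (-s) * α + (-s) ^ 2 * β + (-s) ^ 3 * γ = 0)
    (h3 : (s / 2) * α + (s / 2) ^ 2 * β + (s / 2) ^ 3 * γ = 0)
    (h4 : (-(s / 2)) * α + (-(s / 2)) ^ 2 * β + (-(s / 2)) ^ 3 * γ = 0) : β = 0 ∧ γ = 0 := by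
  have hs2 : s ^ 2 ≠ 0 := pow_ne_zero 2 hs
  have hs3 : s ^ 3 ≠ 0 := pow_ne_zero 3 hs
  have hβ : s ^ 2 * β = 0 := by linear_combination (h1 + h2) / 2
  have hβ0 : β = 0 := by
    rcases mul_eq_zero.mp hβ with h | h
    · exact absurd h hs2
    · exact h
  have hγ : s ^ 3 * γ = 0 := by linear_combination (2 : ℝ) / 3 * (h1 - h2) - (4 : ℝ) / 3 * (h3 - h4)
  have hγ0 : γ = 0 := by
    rcases mul_eq_zero.mp hγ with h | h
    · exact absurd h hs3
    · exact h
  exact ⟨hβ0, hγ0⟩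

/-- ★ **POTENTIAL JERK RIGIDITY ON THE AFFINE-QUADRATIC STRATUM (non-stagnation centre).**  For the harmonic potential
`h(x) = h₀ + ⟪v, x⟫ + ½xᵀSx`, `S = diag(a,b,c)` trace-free, `v` arbitrary, with radial-jerk tower `θ` of the steady drift
`∇h` about the centre `0`: if the single minor `⟪∇θ₀, ∇θ₁ × ∇θ₂⟫` vanishes on a ball about `0`, then `h` is axisymmetric about
an axis through `0` — `∃ e ≠ 0, ∀ x, Dh(x)[e × x] = 0` (on all of `ℝ³`).  The model case `v = 0` is the sketch's
`vandermonde_closure`; `v ≠ 0` (the centre is NOT a stagnation point of the drift) is new. -/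
theorem potentialJerkRigidity_affineQuadratic (htr : a + b + c = 0) {R : ℝ} (hR : 0 < R)
    (hmin : ∀ x ∈ Metric.ball (0 : E3) R,
      inner ℝ (gradient (radialJerk (fun (_ : ℝ) (z : E3) =>
          gradient (fun y : E3 => h₀ + inner ℝ v y + quadForm a b c y / 2) z) 0 0 0) x)
        (cross
          (gradient (radialJerk (fun (_ : ℝ) (z : E3) =>
            gradient (fun y : E3 => h₀ + inner ℝ v y + quadForm a b c y / 2) z) 0 1 0) x)
          (gradient (radialJerk (fun (_ : ℝ) (z : E3) =>
            gradient (fun y : E3 => h₀ + inner ℝ v y + quadForm a b c y / 2) z) 0 2 0) x)) = 0) :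
    ∃ e : E3, e ≠ 0 ∧ ∀ x : E3,
      fderiv ℝ (fun y : E3 => h₀ + inner ℝ v y + quadForm a b c y / 2) x (cross e x) = 0 := by
  -- the drift in closed form
  have hu : (fun (_ : ℝ) (z : E3) => gradient (fun y : E3 => h₀ + inner ℝ v y + quadForm a b c y / 2) z)
      = fun (_ : ℝ) (z : E3) => v + strain a b c z := by
    funext s z; exact gradient_affineQuadratic h₀ a b c v z
  rw [hu] at hmin
  -- the three gradients in closed form
  have h0 : radialJerk (fun (_ : ℝ) (z : E3) => v + strain a b c z) 0 0 0 = fun y : E3 => ‖y - 0‖ ^ 2 / 2 := rfl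
  have hg0 : ∀ x : E3, gradient (radialJerk (fun (_ : ℝ) (z : E3) => v + strain a b c z) 0 0 0) x = x := by
    intro x; rw [h0, gradient_radial, sub_zero]
  have hg1 : ∀ x : E3, gradient (radialJerk (fun (_ : ℝ) (z : E3) => v + strain a b c z) 0 1 0) x
      = v + (2 : ℝ) • strain a b c x := by
    intro x; rw [radialJerk_one_affineQuadratic, gradient_thetaOne_affineQuadratic]
  have hg2 : ∀ x : E3, gradient (radialJerk (fun (_ : ℝ) (z : E3) => v + strain a b c z) 0 2 0) x
      = (3 : ℝ) • strain a b c v + (4 : ℝ) • strain (a ^ 2) (b ^ 2) (c ^ 2) x := by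
    intro x; rw [radialJerk_two_affineQuadratic, gradient_thetaTwo_affineQuadratic]
  -- the minor along rays: P₂(y) = 0 and P₃(y) = 0 for every direction y
  have hray : ∀ y : E3,
      (4 * (y 0 * (v 1 * (c ^ 2 * y 2) - v 2 * (b ^ 2 * y 1)) - y 1 * (v 0 * (c ^ 2 * y 2) - v 2 * (a ^ 2 * y 0))
          + y 2 * (v 0 * (b ^ 2 * y 1) - v 1 * (a ^ 2 * y 0)))
        + 6 * (y 0 * (b * y 1 * (c * v 2) - c * y 2 * (b * v 1)) - y 1 * (a * y 0 * (c * v 2) - c * y 2 * (a * v 0))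
          + y 2 * (a * y 0 * (b * v 1) - b * y 1 * (a * v 0)))) = 0
      ∧ 8 * ((a - b) * (b - c) * (c - a)) * (y 0 * y 1 * y 2) = 0 := by
    intro y
    set s : ℝ := R / (2 * (‖y‖ + 1)) with hsdef
    have hy1 : 0 < ‖y‖ + 1 := by positivity
    have hy1' : ‖y‖ + 1 ≠ 0 := hy1.ne'
    have hs : 0 < s := by rw [hsdef]; positivity
    have hsy : s * ‖y‖ < R := by
      rw [hsdef]
      have : R / (2 * (‖y‖ + 1)) * ‖y‖ = R / 2 * (‖y‖ / (‖y‖ + 1)) := by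
        field_simp
      rw [this]
      have h1 : ‖y‖ / (‖y‖ + 1) < 1 := (div_lt_one hy1).mpr (by linarith)
      have h2 : 0 ≤ ‖y‖ / (‖y‖ + 1) := by positivity
      nlinarith
    have hmem : ∀ t : ℝ, |t| ≤ s → t • y ∈ Metric.ball (0 : E3) R := by
      intro t ht
      rw [mem_ball_zero_iff, norm_smul, Real.norm_eq_abs]
      calc |t| * ‖y‖ ≤ s * ‖y‖ := mul_le_mul_of_nonneg_right ht (norm_nonneg _)
        _ < R := hsy
    have hval : ∀ t : ℝ, |t| ≤ s →
        t * (3 * (y 0 * (v 1 * (c * v 2) - v 2 * (b * v 1)) - y 1 * (v 0 * (c * v 2) - v 2 * (a * v 0))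
                + y 2 * (v 0 * (b * v 1) - v 1 * (a * v 0))))
        + t ^ 2 * (4 * (y 0 * (v 1 * (c ^ 2 * y 2) - v 2 * (b ^ 2 * y 1)) - y 1 * (v 0 * (c ^ 2 * y 2) - v 2 * (a ^ 2 * y 0))
                + y 2 * (v 0 * (b ^ 2 * y 1) - v 1 * (a ^ 2 * y 0)))
              + 6 * (y 0 * (b * y 1 * (c * v 2) - c * y 2 * (b * v 1)) - y 1 * (a * y 0 * (c * v 2) - c * y 2 * (a * v 0))
                + y 2 * (a * y 0 * (b * v 1) - b * y 1 * (a * v 0))))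
        + t ^ 3 * (8 * ((a - b) * (b - c) * (c - a)) * (y 0 * y 1 * y 2)) = 0 := by
      intro t ht
      have h := hmin (t • y) (hmem t ht)
      rw [hg0, hg1, hg2, minor_affineQuadratic_ray] at h
      exact h
    have e1 := hval s (by rw [abs_of_pos hs])
    have e2 := hval (-s) (by rw [abs_neg, abs_of_pos hs])
    have e3 := hval (s / 2) (by rw [abs_of_pos (by positivity)]; linarith)
    have e4 := hval (-(s / 2)) (by rw [abs_neg, abs_of_pos (by positivity)]; linarith)
    exact cubic_coeffs_eq_zero hs.ne' e1 e2 e3 e4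
  -- the conclusion in closed form: `Dh(x)[e × x] = ⟪v + Sx, e × x⟫`
  have hconcl : ∀ e x : E3, fderiv ℝ (fun y : E3 => h₀ + inner ℝ v y + quadForm a b c y / 2) x (cross e x)
      = (v 0 + a * x 0) * (e 1 * x 2 - e 2 * x 1) + (v 1 + b * x 1) * (e 2 * x 0 - e 0 * x 2)
        + (v 2 + c * x 2) * (e 0 * x 1 - e 1 * x 0) := by
    intro e x
    rw [fderiv_affineQuadratic_apply]
    simp [cross, crossProduct, strain, EuclideanSpace.inner_eq_star_dotProduct, dotProduct, Fin.sum_univ_three,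
    Matrix.vecHead, Matrix.vecTail, Function.comp_apply, Fin.succ_zero_eq_one, Fin.succ_one_eq_two]
    ring
  -- coordinates of the test directions / axes
  have cvec : ∀ p q r : ℝ, (WithLp.toLp 2 ![p, q, r] : E3) 0 = p ∧ (WithLp.toLp 2 ![p, q, r] : E3) 1 = q
      ∧ (WithLp.toLp 2 ![p, q, r] : E3) 2 = r := fun p q r => by simp
  have c111 := cvec 1 1 1
  have c110 := cvec 1 1 0
  have c101 := cvec 1 0 1
  have c011 := cvec 0 1 1
  have c100 := cvec 1 0 0
  have c010 := cvec 0 1 0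
  have c001 := cvec 0 0 1
  -- Vandermonde: two principal strains coincide
  have hV : (a - b) * (b - c) * (c - a) = 0 := by
    have h := (hray (WithLp.toLp 2 ![(1 : ℝ), 1, 1])).2
    rw [c111.1, c111.2.1, c111.2.2] at h
    linear_combination h / 8
  -- `P₂` at the three coordinate bisectors
  have h110 : c * (a - b) * v 2 = 0 := by
    have h := (hray (WithLp.toLp 2 ![(1 : ℝ), 1, 0])).1
    rw [c110.1, c110.2.1, c110.2.2] at h
    linear_combination (-(1 : ℝ) / 10) * h + (2 : ℝ) / 5 * (a - b) * v 2 * htr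
  have h101 : b * (c - a) * v 1 = 0 := by
    have h := (hray (WithLp.toLp 2 ![(1 : ℝ), 0, 1])).1
    rw [c101.1, c101.2.1, c101.2.2] at h
    linear_combination (-(1 : ℝ) / 10) * h + (2 : ℝ) / 5 * (c - a) * v 1 * htr
  have h011 : a * (b - c) * v 0 = 0 := by
    have h := (hray (WithLp.toLp 2 ![(0 : ℝ), 1, 1])).1
    rw [c011.1, c011.2.1, c011.2.2] at h
    linear_combination (-(1 : ℝ) / 10) * h + (2 : ℝ) / 5 * (b - c) * v 0 * htr
  -- case analysis on which two strains coincide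
  by_cases hS : a = 0 ∧ b = 0
  · -- S = 0: h is affine, axis = v (or anything if v = 0)
    obtain ⟨ha, hb⟩ := hS
    have hc : c = 0 := by linarith
    by_cases hv : v = 0
    · refine ⟨WithLp.toLp 2 ![(1 : ℝ), 0, 0], ?_, fun x => ?_⟩
      · intro h
        have h' := c100.1
        rw [h, PiLp.zero_apply] at h'
        exact one_ne_zero h'.symm
      · rw [hconcl, hv, ha, hb, hc, c100.1, c100.2.1, c100.2.2, PiLp.zero_apply, PiLp.zero_apply, PiLp.zero_apply]
        ring
    · refine ⟨v, hv, fun x => ?_⟩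
      rw [hconcl, ha, hb, hc]; ring
  · -- exactly two coincide (all three equal would force S = 0)
    rcases mul_eq_zero.mp hV with hV' | hca
    · rcases mul_eq_zero.mp hV' with hab | hbc
      · -- a = b ≠ c: axis e₂, need v 0 = v 1 = 0
        have hab' : a = b := sub_eq_zero.mp hab
        have ha0 : a ≠ 0 := by
          intro ha; exact hS ⟨ha, by rw [← hab']; exact ha⟩
        have hbc' : b - c ≠ 0 := by
          intro h; apply ha0; have : b = c := sub_eq_zero.mp h; linarith
        have hca' : c - a ≠ 0 := by
          intro h; apply ha0; have : c = a := sub_eq_zero.mp h; linarith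
        have hv0 : v 0 = 0 := by
          rcases mul_eq_zero.mp h011 with h | h
          · rcases mul_eq_zero.mp h with h | h
            · exact absurd h ha0
            · exact absurd h hbc'
          · exact h
        have hv1 : v 1 = 0 := by
          rcases mul_eq_zero.mp h101 with h | h
          · rcases mul_eq_zero.mp h with h | h
            · exact absurd (hab'.trans h) ha0
            · exact absurd h hca'
          · exact h
        refine ⟨WithLp.toLp 2 ![(0 : ℝ), 0, 1], ?_, fun x => ?_⟩
        · intro h
          have h' := c001.2.2
          rw [h, PiLp.zero_apply] at h'
          exact one_ne_zero h'.symm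
        · rw [hconcl, hv0, hv1, hab', c001.1, c001.2.1, c001.2.2]; ring
      · -- b = c ≠ a: axis e₀, need v 1 = v 2 = 0
        have hbc' : b = c := sub_eq_zero.mp hbc
        have hb0 : b ≠ 0 := by
          intro hb; exact hS ⟨by linarith, hb⟩
        have hab' : a - b ≠ 0 := by
          intro h; apply hb0; have : a = b := sub_eq_zero.mp h; linarith
        have hca' : c - a ≠ 0 := by
          intro h; apply hb0; have : c = a := sub_eq_zero.mp h; linarith
        have hv2 : v 2 = 0 := by
          rcases mul_eq_zero.mp h110 with h | h
          · rcases mul_eq_zero.mp h with h | h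
            · exact absurd (hbc'.trans h) hb0
            · exact absurd h hab'
          · exact h
        have hv1 : v 1 = 0 := by
          rcases mul_eq_zero.mp h101 with h | h
          · rcases mul_eq_zero.mp h with h | h
            · exact absurd h hb0
            · exact absurd h hca'
          · exact h
        refine ⟨WithLp.toLp 2 ![(1 : ℝ), 0, 0], ?_, fun x => ?_⟩
        · intro h
          have h' := c100.1
          rw [h, PiLp.zero_apply] at h'
          exact one_ne_zero h'.symm
        · rw [hconcl, hv1, hv2, hbc', c100.1, c100.2.1, c100.2.2]; ring
    · -- c = a ≠ b: axis e₁, need v 0 = v 2 = 0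
      have hca' : c = a := sub_eq_zero.mp hca
      have ha0 : a ≠ 0 := by
        intro ha; exact hS ⟨ha, by linarith⟩
      have hab' : a - b ≠ 0 := by
        intro h; apply ha0; have : a = b := sub_eq_zero.mp h; linarith
      have hbc' : b - c ≠ 0 := by
        intro h; apply ha0; have : b = c := sub_eq_zero.mp h; linarith
      have hv0 : v 0 = 0 := by
        rcases mul_eq_zero.mp h011 with h | h
        · rcases mul_eq_zero.mp h with h | h
          · exact absurd h ha0
          · exact absurd h hbc'
        · exact h
      have hv2 : v 2 = 0 := by
        rcases mul_eq_zero.mp h110 with h | h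
        · rcases mul_eq_zero.mp h with h | h
          · exact absurd (hca'.symm.trans h) ha0
          · exact absurd h hab'
        · exact h
      refine ⟨WithLp.toLp 2 ![(0 : ℝ), 1, 0], ?_, fun x => ?_⟩
      · intro h
        have h' := c010.2.1
        rw [h, PiLp.zero_apply] at h'
        exact one_ne_zero h'.symm
      · rw [hconcl, hv0, hv2, hca', c010.1, c010.2.1, c010.2.2]; ring

end AffineQuadratic

end Summit.NavierStokesRegularity.NavierStokesRegularity.Theorems.PoloidalLiouville.ErtelTower
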